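import Summits.QuantumFields.YangMills.Theorems.LuscherReductionTwistedTraceScalingFPWeightLaplace
import Summits.QuantumFields.YangMills.Theorems.LuscherReductionTwistedTraceScalingFPWeightGaussianValue
import HarnessLib

/-!
# (N2) in closed form: the Faddeev–Popov weight at a slice point between two EXPLICIT Gaussian expressions `(2π²)^{-n}(πs²)^{3n/2}/√gramDet(p*) · (1 ± …)`
# (lane A of S-BASE, crux `TwistedTraceScaling` stmt-QuantumFields-20203, C4 INNER; design note `pub/ym-fleet/ym-luscher-20007-p1/COARSE-DESIGN.md` §23.12)

Substituting the Gaussian values `I(a) = (πs²/a)^{d/2}/√gramDet p` (`laplaceIntegral_eq`, p638140) into `fpWeight_laplace_bounds` (p636367), `d = 3n` the dimension of the flat based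
coordinates:
★★★ `fpWeight_explicit_bounds`:
  `(2π²)^{-n} e^{−6nR₁²}·[(πs²/(1+η))^{d/2} − e^{−c²r²/2s²}(2πs²)^{d/2}]/√gramDet p ≤ N(U*) ≤ (2π²)^{-n}·[(πs²/(1−η))^{d/2} + e^{−c²r²/4s²}(4πs²)^{d/2}]/√gramDet p`
under the hypotheses of `fpWeight_laplace_bounds` and `p` within the injectivity radius.  With `exists_gramDet_sq_bound` (p637998: `gramDet p = gramDet 0·(1 + O(‖p‖²))`) this is the
complete asymptotics of the Faddeev–Popov weight on the Born–Oppenheimer core (§23.12).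
HONEST FRAMING: bookkeeping for a stub of a child of the CONDITIONAL reduction route R2b1; no spectral claim; C4 OPEN; not a gap, not Clay.
-/

set_option autoImplicit false

noncomputable section

open MeasureTheory Filter Topology Real Module
open scoped BigOperators
open Literature.MathematicalPhysics.QuantumFieldTheory
open Literature.MathematicalPhysics.QuantumLattice

namespace Summit.QuantumFields.YangMills.Theorems.FemtoTransferGap.TwoLattice.ConstTube

open Summit.QuantumFields.YangMills.Theorems.FemtoTransferGap
open Summit.QuantumFields.YangMills.Theorems.FemtoTransferGap.TwoLattice.Avg
open Summit.QuantumFields.YangMills.Theorems.FemtoTransferGap.TwoLattice.Stiff (LinkSpace)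

variable (L : ℕ) [NeZero L]

/-- ★★★ **THE FADDEEV–POPOV WEIGHT AT A SLICE POINT, IN CLOSED FORM.** [cite: Luscher1983, §3] -/
theorem fpWeight_explicit_bounds (hL : Nonempty (NzSite L)) {δ ρ δg : ℝ → ℝ} {β : ℝ} (hs : 0 < δg β)
    (p : balancedSubmodule L × (Fin 3 → Fin 3 → ℝ))
    (hpI : ∀ {a s : ℝ}, 0 < a → 0 < s →
      ∫ w, Real.exp (-(a * ‖laplaceMap L p w‖ ^ 2 / s ^ 2)) ∂(volume : Measure (NzSite L → Fin 3 → ℝ)) =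
        (π * s ^ 2 / a) ^ (finrank ℝ (EuclideanSpace ℝ (NzSite L × Fin 3)) / 2 : ℝ) / Real.sqrt (gramDet L p))
    {εT M : ℝ} (hM0 : 0 ≤ M) (hεT : 0 < εT)
    (hT : ∀ (ξ : basedSubmodule L) (q : balancedSubmodule L × (Fin 3 → Fin 3 → ℝ)), ‖ξ‖ < εT → ‖q‖ < εT →
      ‖basedFn L (ξ, q) - basedFn L (0, q) - basedLin L q ξ‖ ≤ M * ‖ξ‖ ^ 2)
    {εC : ℝ} (hC : ∀ q : balancedSubmodule L × (Fin 3 → Fin 3 → ℝ), ‖q‖ < εC →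
      ∀ ξ : basedSubmodule L, ‖ξ‖ ≤ 4 * sliceConst L * ‖(gaugeModes L).starProjection (basedLin L q ξ)‖)
    (hpT : ‖p‖ < εT) (hpC : ‖p‖ < εC) (hp40 : ‖p‖ ≤ 1 / 40)
    (hslice : (gaugeModes L).starProjection (linkEmbed L (p.1 : Edge 3 L → Fin 3 → ℝ)) = 0)
    {ρ₁ : ℝ} (hU : tubePt L p ∈ fatTubeRho L δ (fun _ => ρ₁) β)
    {r R₁ : ℝ} (hr0 : 0 ≤ r) (hrR : r ≤ R₁) (hR1 : R₁ ≤ 1 / 2) (hR1T : R₁ < εT) (hcore : ρ₁ + 8 * r ≤ ρ β)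
    (hsupp : 3 * ((L : ℝ) - 1) * (ρ₁ + ρ β) ≤ R₁)
    (hθ : (M + 2 * ‖basedLin L p‖) * R₁ * (4 * sliceConst L) ≤ 1 / 4) :
    let n := Fintype.card (NzSite L)
    let d := finrank ℝ (EuclideanSpace ℝ (NzSite L × Fin 3))
    let s := δg β
    let c := 1 / (4 * sliceConst L)
    let η := 3 * ((M + 2 * ‖basedLin L p‖) * r * (4 * sliceConst L))
    ((2 * π ^ 2)⁻¹) ^ n * Real.exp (-(6 * n * R₁ ^ 2)) *
        ((π * s ^ 2 / (1 + η)) ^ (d / 2 : ℝ) / Real.sqrt (gramDet L p) -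
          Real.exp (-(c ^ 2 * r ^ 2 / (2 * s ^ 2))) * ((π * s ^ 2 / (1 / 2)) ^ (d / 2 : ℝ) / Real.sqrt (gramDet L p))) ≤
        gaugeAvg (recordWeightRho L δ ρ δg β) (tubePt L p) ∧
      gaugeAvg (recordWeightRho L δ ρ δg β) (tubePt L p) ≤ ((2 * π ^ 2)⁻¹) ^ n *
        ((π * s ^ 2 / (1 - η)) ^ (d / 2 : ℝ) / Real.sqrt (gramDet L p) +
          Real.exp (-(c ^ 2 * r ^ 2 / (4 * s ^ 2))) * ((π * s ^ 2 / (1 / 4)) ^ (d / 2 : ℝ) / Real.sqrt (gramDet L p))) := by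
  intro n d s c η
  have hCpos := sliceConst_pos L
  have hθr4 : (M + 2 * ‖basedLin L p‖) * r * (4 * sliceConst L) ≤ 1 / 4 :=
    (mul_le_mul_of_nonneg_right (mul_le_mul_of_nonneg_left hrR (by positivity)) (by positivity)).trans hθ
  have hη1 : 0 < 1 + η := by show 0 < 1 + 3 * ((M + 2 * ‖basedLin L p‖) * r * (4 * sliceConst L)); positivity
  have hη2 : 0 < 1 - η := by show 0 < 1 - 3 * ((M + 2 * ‖basedLin L p‖) * r * (4 * sliceConst L)); linarith
  obtain ⟨hlo, hhi⟩ := fpWeight_laplace_bounds L hL hs p hM0 hεT hT hC hpT hpC hp40 hslice hU hr0 hrR hR1 hR1T hcore hsupp hθ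
  have e1 := hpI hη1 hs
  have e2 := hpI (show (0 : ℝ) < 1 / 2 by norm_num) hs
  have e3 := hpI hη2 hs
  have e4 := hpI (show (0 : ℝ) < 1 / 4 by norm_num) hs
  simp only [] at hlo hhi
  rw [e1, e2] at hlo
  rw [e3, e4] at hhi
  exact ⟨hlo, hhi⟩

end Summit.QuantumFields.YangMills.Theorems.FemtoTransferGap.TwoLattice.ConstTube

end
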